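import Mathlib
import Literature.Computability.AlgebraicComplexity.ArithCircuitProofs
import Literature.Computability.AlgebraicComplexity.MatMulTotalComplexityProofs
import Literature.Computability.AlgebraicComplexity.FastFourierTransform
import Literature.LinearAlgebra.Matrix.CauchyDeterminant
import Literature.Computability.AlgebraicComplexity.DivisionSLP
import Literature.LinearAlgebra.Matrix.CauchyLike

/-!
# Stub `stub_cauchyMatvec` of crux `HiddenToeplitzCorners.ToeplitzLikeDetCost` (stmt-MatrixMultiplication-7491),
# line `Sketch`

Cauchy-like matrix-vector products on twisted root-of-unity coset grids (K-level).

Target tree file: `Summits/MatrixMultiplication/MatrixMultiplication/Theorems/HiddenToeplitzCornersToeplitzLikeDetCostCauchyMatvec.lean`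
(helper for the crux, landed with `--supports stmt-MatrixMultiplication-7491`). The theorem `stub_cauchyMatvec`
below must keep EXACTLY this name and signature (it is registered on the crux).
-/

set_option linter.dupNamespace false

namespace Summit.MatrixMultiplication.MatrixMultiplication.Theorems

open scoped BigOperators Matrix
open Literature.Computability.AlgebraicComplexity Literature.LinearAlgebra.Matrix
open Literature.Computability.AlgebraicComplexity.ArithCircuit (FanInTwoSeq freeInputs)

noncomputable section

section KLevel
variable {K : Type} [Field K] [Algebra ℂ K]

/-- For a primitive `2^κ`-th root of unity `ω ∈ ℂ` and `κ ≠ 0`, `ω ^ 2^(κ-1) = -1`, also after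
mapping to `K` (the hypothesis of `fft_eq_dft`). [folklore] -/
theorem algebraMap_pow_half_eq_neg_one {κ : ℕ} {ω : ℂ} (hω : IsPrimitiveRoot ω (2 ^ κ))
    (hκ : κ ≠ 0) : algebraMap ℂ K ω ^ 2 ^ (κ - 1) = -1 := by
  have h2 : IsPrimitiveRoot (ω ^ 2 ^ (κ - 1)) 2 :=
    hω.pow (by positivity) (by rw [← pow_succ, Nat.sub_add_cancel (Nat.one_le_iff_ne_zero.2 hκ)])
  rw [← map_pow, h2.eq_neg_one_of_two_right, map_neg, map_one]

/-- The image in `K` of a primitive `2^κ`-th root of unity of `ℂ` is a principal `2^κ`-th root of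
unity. [folklore] -/
theorem isPrincipalRoot_algebraMap {κ : ℕ} {ω : ℂ} (hω : IsPrimitiveRoot ω (2 ^ κ)) :
    IsPrincipalRoot (2 ^ κ) (algebraMap ℂ K ω) := by
  rcases Nat.eq_zero_or_pos κ with rfl | hκ
  · refine ⟨?_, fun m hm0 hmt => ?_⟩
    · have : ω = 1 := by simpa using hω
      simp [this]
    · simp at hmt; omega
  · have h := IsPrincipalRoot.of_pow_eq_neg_one (κ - 1)
      (algebraMap_pow_half_eq_neg_one (K := K) hω hκ.ne')
    rwa [Nat.sub_add_cancel hκ] at h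

/-- The Cauchy kernel between the cosets `a⟨ω⟩` and `b⟨ω⟩` (`ω ^ t = 1`) is "diagonal × circulant":
`ε / (a ω^i - b ω^j) = ε (a ω^i)⁻¹ · g ((i - j) mod t)` with `g s = (1 - (b/a) ω^{-s})⁻¹`.
[folklore] -/
theorem cauchy_kernel_factor {t : ℕ} {ω a b : ℂ} (hωt : ω ^ t = 1) (hω0 : ω ≠ 0) (ha : a ≠ 0)
    (hab : ∀ i j : ℕ, a * ω ^ i ≠ b * ω ^ j) (ε : ℂ) (i : ℕ) {j : ℕ} (hj : j ≤ t) :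
    ε / (a * ω ^ i - b * ω ^ j) =
      ε * (a * ω ^ i)⁻¹ * (1 - b / a * (ω ^ ((i + (t - j)) % t))⁻¹)⁻¹ := by
  rw [← pow_eq_pow_mod_of_pow_eq_one hωt]
  have hωj : ω ^ (t - j) = (ω ^ j)⁻¹ := by
    refine eq_inv_of_mul_eq_one_left ?_
    rw [← pow_add, Nat.sub_add_cancel hj, hωt]
  rw [pow_add, hωj]
  have h1 : a * ω ^ i - b * ω ^ j ≠ 0 := sub_ne_zero.2 (hab i j)
  have hωi : ω ^ i ≠ 0 := pow_ne_zero _ hω0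
  have hωj0 : ω ^ j ≠ 0 := pow_ne_zero _ hω0
  field_simp

/-- (`t : K`) is invertible in a `ℂ`-algebra field. [folklore] -/
theorem natCast_two_pow_ne_zero (κ : ℕ) : ((2 ^ κ : ℕ) : K) ≠ 0 := by
  rw [← map_natCast (algebraMap ℂ K)]
  exact (map_ne_zero _).2 (Nat.cast_ne_zero.2 (pow_ne_zero κ two_ne_zero))

/-- **Cyclic convolution with a constant sequence by two FFTs** (GG Lemma 8.11 + Thm 8.13 read
through `fft_eq_dft`): for `i < t = 2^κ`,
`(w ⋆ g)_i = t⁻¹ · FFT(ĝ · FFT(w))_{(t - i) mod t}` with `ĝ = DFT(g)` precomputed in `ℂ`.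
[folklore] -/
theorem cconv_eq_fft {κ : ℕ} {ω : ℂ} (hω : IsPrimitiveRoot ω (2 ^ κ)) (w : ℕ → K) (g : ℕ → ℂ)
    {i : ℕ} (hi : i < 2 ^ κ) :
    cconv (2 ^ κ) w (fun s => algebraMap ℂ K (g s)) i =
      algebraMap ℂ K (((2 ^ κ : ℕ) : ℂ)⁻¹) *
        fft κ (algebraMap ℂ K ω) (fun l => algebraMap ℂ K (dft (2 ^ κ) ω g l) *
          fft κ (algebraMap ℂ K ω) w l) ((2 ^ κ - i) % 2 ^ κ) := by
  have hprinc := isPrincipalRoot_algebraMap (K := K) hω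
  have hhalf : κ ≠ 0 → algebraMap ℂ K ω ^ 2 ^ (κ - 1) = -1 :=
    fun hκ => algebraMap_pow_half_eq_neg_one hω hκ
  have htpos : 0 < 2 ^ κ := by positivity
  have hidx : (2 ^ κ - i) % 2 ^ κ < 2 ^ κ := Nat.mod_lt _ htpos
  have h1 : ((2 ^ κ - i) % 2 ^ κ + i) % 2 ^ κ = 0 :=
    (add_mod_eq_zero_iff_eq_sub_mod hidx hi).2 rfl
  have hrev : (2 ^ κ - (2 ^ κ - i) % 2 ^ κ) % 2 ^ κ = i := by
    rw [add_comm] at h1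
    exact ((add_mod_eq_zero_iff_eq_sub_mod hi hidx).1 h1).symm
  have key := dft_dft hprinc (cconv (2 ^ κ) w (fun s => algebraMap ℂ K (g s))) hidx
  rw [hrev] at key
  have hE : dft (2 ^ κ) (algebraMap ℂ K ω)
      (dft (2 ^ κ) (algebraMap ℂ K ω) (cconv (2 ^ κ) w (fun s => algebraMap ℂ K (g s))))
      ((2 ^ κ - i) % 2 ^ κ) = dft (2 ^ κ) (algebraMap ℂ K ω)
      (fun l => algebraMap ℂ K (dft (2 ^ κ) ω g l) * fft κ (algebraMap ℂ K ω) w l)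
      ((2 ^ κ - i) % 2 ^ κ) := by
    refine dft_congr (fun l hl => ?_) _
    rw [dft_cconv hprinc.pow_eq_one, fft_eq_dft κ _ w hhalf l hl, map_dft, mul_comm]
    rfl
  rw [fft_eq_dft κ _ _ hhalf _ hidx, ← hE, key, map_inv₀, map_natCast, ← mul_assoc,
    inv_mul_cancel₀ (natCast_two_pow_ne_zero κ), one_mul]

/-- **The coset Cauchy kernel applied to a vector = diagonal scaling ∘ FFT ∘ diagonal ∘ FFT.**
[folklore] -/
theorem cauchy_kernel_apply {κ : ℕ} {ω a b : ℂ} (hω : IsPrimitiveRoot ω (2 ^ κ)) (ha : a ≠ 0)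
    (hab : ∀ i j : ℕ, a * ω ^ i ≠ b * ω ^ j) (ε : ℂ) (w : Fin (2 ^ κ) → K) (i : Fin (2 ^ κ)) :
    ∑ j : Fin (2 ^ κ), algebraMap ℂ K (ε / (a * ω ^ (i : ℕ) - b * ω ^ (j : ℕ))) * w j =
      algebraMap ℂ K (ε * (a * ω ^ (i : ℕ))⁻¹ * ((2 ^ κ : ℕ) : ℂ)⁻¹) *
        fft κ (algebraMap ℂ K ω)
          (fun l => algebraMap ℂ K (dft (2 ^ κ) ω (fun s => (1 - b / a * (ω ^ s)⁻¹)⁻¹) l) *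
            fft κ (algebraMap ℂ K ω) (fun j => if h : j < 2 ^ κ then w ⟨j, h⟩ else 0) l)
          ((2 ^ κ - (i : ℕ)) % 2 ^ κ) := by
  set g : ℕ → ℂ := fun s => (1 - b / a * (ω ^ s)⁻¹)⁻¹ with hg
  set w' : ℕ → K := fun j => if h : j < 2 ^ κ then w ⟨j, h⟩ else 0 with hw'
  have hωt := hω.pow_eq_one
  have hω0 : ω ≠ 0 := hω.ne_zero (by positivity)
  have h1 : ∀ j ∈ (Finset.univ : Finset (Fin (2 ^ κ))),
      algebraMap ℂ K (ε / (a * ω ^ (i : ℕ) - b * ω ^ (j : ℕ))) * w j =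
      algebraMap ℂ K (ε * (a * ω ^ (i : ℕ))⁻¹) *
        (w' j * algebraMap ℂ K (g (((i : ℕ) + (2 ^ κ - j)) % 2 ^ κ))) := by
    intro j _
    rw [cauchy_kernel_factor hωt hω0 ha hab ε i (le_of_lt j.2), map_mul]
    have : w' j = w j := by simp [hw', j.2]
    rw [this]; ring
  rw [Finset.sum_congr rfl h1, ← Finset.mul_sum,
    Fin.sum_univ_eq_sum_range
      (fun j => w' j * algebraMap ℂ K (g (((i : ℕ) + (2 ^ κ - j)) % 2 ^ κ))) (2 ^ κ)]
  change _ * cconv (2 ^ κ) w' (fun s => algebraMap ℂ K (g s)) i = _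
  rw [cconv_eq_fft hω w' g i.2, ← mul_assoc, ← map_mul]

/-- **Cost of `i ↦ c_i · FFT(ĝ · FFT(w))_{(t-i) mod t}`**: two FFTs (hypothesis `hfft`) and `2t`
scalings by constants, `(2κ + 2) · 2^κ` steps in total. [folklore] -/
theorem derivable_fft_sandwich (hfft : ∀ (κ : ℕ) (ω : ℂ) (a : ℕ → K) (A : Set K),
      (∀ i < 2 ^ κ, a i ∈ A ∪ Set.range (algebraMap ℂ K)) →
      Derivable ℂ (κ * 2 ^ κ) A {v | ∃ j < 2 ^ κ, v = fft κ (algebraMap ℂ K ω) a j})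
    (κ : ℕ) (ω : ℂ) (ĝ : ℕ → ℂ) (c : Fin (2 ^ κ) → ℂ) (w : Fin (2 ^ κ) → K) (B : Set K)
    (hw : ∀ j, w j ∈ B ∪ Set.range (algebraMap ℂ K)) :
    Derivable ℂ ((2 * κ + 2) * 2 ^ κ) B (Set.range fun i : Fin (2 ^ κ) =>
      algebraMap ℂ K (c i) * fft κ (algebraMap ℂ K ω) (fun l => algebraMap ℂ K (ĝ l) *
        fft κ (algebraMap ℂ K ω) (fun j => if h : j < 2 ^ κ then w ⟨j, h⟩ else 0) l)
        ((2 ^ κ - (i : ℕ)) % 2 ^ κ)) := by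
  set ωK := algebraMap ℂ K ω with hωK
  set w' : ℕ → K := fun j => if h : j < 2 ^ κ then w ⟨j, h⟩ else 0 with hw'
  set z : ℕ → K := fun l => algebraMap ℂ K (ĝ l) * fft κ ωK w' l with hz
  -- Stage 1: FFT of `w'`
  set F1 : Set K := {x | ∃ j < 2 ^ κ, x = fft κ ωK w' j} with hF1
  have h1 : Derivable ℂ (κ * 2 ^ κ) B F1 := by
    refine hfft κ ω w' B (fun i hi => ?_)
    simp only [hw', dif_pos hi]
    exact hw _
  -- Stage 2: scalings by `ĝ l`
  set Z : Set K := {x | ∃ l < 2 ^ κ, x = z l} with hZ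
  have h2 : Derivable ℂ (2 ^ κ) (B ∪ F1) Z := by
    have key := Derivable.biUnion (k := ℂ) (Finset.range (2 ^ κ)) (c := fun _ => 1) (A := B ∪ F1)
      (B := fun l => ({z l} : Set K)) (fun l hl => ?_)
    · refine key.mono (by simp) le_rfl ?_
      rintro x ⟨l, hl, rfl⟩
      exact Set.mem_biUnion (Finset.mem_coe.2 (Finset.mem_range.2 hl)) rfl
    · have hl' := Finset.mem_range.1 hl
      have hs := Derivable.smul (k := ℂ) (A := B ∪ F1) (x := fft κ ωK w' l)
        (Or.inl (Or.inr ⟨l, hl', rfl⟩)) (ĝ l)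
      simpa [hz, Algebra.smul_def] using hs
  -- Stage 3: FFT of `z`
  set F2 : Set K := {x | ∃ j < 2 ^ κ, x = fft κ ωK z j} with hF2
  have h3 : Derivable ℂ (κ * 2 ^ κ) ((B ∪ F1) ∪ Z) F2 :=
    hfft κ ω z _ (fun l hl => Or.inl (Or.inr ⟨l, hl, rfl⟩))
  -- Stage 4: output scalings by `c i`
  have h4 : Derivable ℂ (2 ^ κ) (((B ∪ F1) ∪ Z) ∪ F2) (Set.range fun i : Fin (2 ^ κ) =>
      algebraMap ℂ K (c i) * fft κ ωK z ((2 ^ κ - (i : ℕ)) % 2 ^ κ)) := by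
    have key := Derivable.biUnion (k := ℂ) (Finset.univ : Finset (Fin (2 ^ κ))) (c := fun _ => 1)
      (A := ((B ∪ F1) ∪ Z) ∪ F2)
      (B := fun i => ({algebraMap ℂ K (c i) * fft κ ωK z ((2 ^ κ - (i : ℕ)) % 2 ^ κ)} : Set K))
      (fun i _ => ?_)
    · refine key.mono (by simp) le_rfl ?_
      rintro x ⟨i, rfl⟩
      exact Set.mem_biUnion (Finset.mem_coe.2 (Finset.mem_univ i)) rfl
    · have hidx : (2 ^ κ - (i : ℕ)) % 2 ^ κ < 2 ^ κ := Nat.mod_lt _ (by positivity)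
      have hs := Derivable.smul (k := ℂ) (A := ((B ∪ F1) ∪ Z) ∪ F2)
        (x := fft κ ωK z ((2 ^ κ - (i : ℕ)) % 2 ^ κ)) (Or.inl (Or.inr ⟨_, hidx, rfl⟩)) (c i)
      simpa [Algebra.smul_def] using hs
  exact (h1.trans (h2.trans (h3.trans h4))).mono (le_of_eq (by ring)) le_rfl le_rfl

/-- **One generator column**: the vector `i ↦ G i k · ∑_j ε/(aω^i − bω^j) · H j k · v j` costs
`(2κ + 4) · 2^κ` steps (products, the FFT sandwich, products). [folklore] -/
theorem derivable_cauchy_column (hfft : ∀ (κ : ℕ) (ω : ℂ) (a : ℕ → K) (A : Set K),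
      (∀ i < 2 ^ κ, a i ∈ A ∪ Set.range (algebraMap ℂ K)) →
      Derivable ℂ (κ * 2 ^ κ) A {v | ∃ j < 2 ^ κ, v = fft κ (algebraMap ℂ K ω) a j})
    {κ : ℕ} {ω a b : ℂ} (hω : IsPrimitiveRoot ω (2 ^ κ)) (ha : a ≠ 0)
    (hab : ∀ i j : ℕ, a * ω ^ i ≠ b * ω ^ j) (ε : ℂ) {p : Type} (G H : Matrix (Fin (2 ^ κ)) p K)
    (v : Fin (2 ^ κ) → K) (A : Set K) (hG : ∀ i k, G i k ∈ A ∪ Set.range (algebraMap ℂ K))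
    (hH : ∀ i k, H i k ∈ A ∪ Set.range (algebraMap ℂ K))
    (hv : ∀ i, v i ∈ A ∪ Set.range (algebraMap ℂ K)) (k : p) :
    Derivable ℂ ((2 * κ + 4) * 2 ^ κ) A (Set.range fun i : Fin (2 ^ κ) => G i k *
      ∑ j : Fin (2 ^ κ), algebraMap ℂ K (ε / (a * ω ^ (i : ℕ) - b * ω ^ (j : ℕ))) *
        (H j k * v j)) := by
  set w : Fin (2 ^ κ) → K := fun j => H j k * v j with hw
  set ĝ : ℕ → ℂ := dft (2 ^ κ) ω (fun s => (1 - b / a * (ω ^ s)⁻¹)⁻¹) with hĝ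
  set c : Fin (2 ^ κ) → ℂ := fun i => ε * (a * ω ^ (i : ℕ))⁻¹ * ((2 ^ κ : ℕ) : ℂ)⁻¹ with hc
  set o : Fin (2 ^ κ) → K := fun i => algebraMap ℂ K (c i) * fft κ (algebraMap ℂ K ω)
    (fun l => algebraMap ℂ K (ĝ l) *
      fft κ (algebraMap ℂ K ω) (fun j => if h : j < 2 ^ κ then w ⟨j, h⟩ else 0) l)
    ((2 ^ κ - (i : ℕ)) % 2 ^ κ) with ho
  have heq : (fun i : Fin (2 ^ κ) => G i k *
      ∑ j : Fin (2 ^ κ), algebraMap ℂ K (ε / (a * ω ^ (i : ℕ) - b * ω ^ (j : ℕ))) *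
        (H j k * v j)) = fun i => G i k * o i := by
    funext i
    rw [cauchy_kernel_apply hω ha hab ε w i]
  rw [heq]
  -- Stage 0: the products `H j k * v j`
  have h0 : Derivable ℂ (2 ^ κ) A (Set.range w) := by
    have key := Derivable.biUnion (k := ℂ) (Finset.univ : Finset (Fin (2 ^ κ))) (c := fun _ => 1)
      (A := A) (B := fun j => ({w j} : Set K)) (fun j _ => Derivable.mul (hH j k) (hv j))
    refine key.mono (by simp) le_rfl ?_
    rintro x ⟨j, rfl⟩
    exact Set.mem_biUnion (Finset.mem_coe.2 (Finset.mem_univ j)) rfl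
  -- Stages 1-4: the FFT sandwich
  have h1 : Derivable ℂ ((2 * κ + 2) * 2 ^ κ) (A ∪ Set.range w) (Set.range o) :=
    derivable_fft_sandwich hfft κ ω ĝ c w _ (fun j => Or.inl (Or.inr ⟨j, rfl⟩))
  -- Stage 5: the products `G i k * o i`
  have h2 : Derivable ℂ (2 ^ κ) ((A ∪ Set.range w) ∪ Set.range o)
      (Set.range fun i => G i k * o i) := by
    have key := Derivable.biUnion (k := ℂ) (Finset.univ : Finset (Fin (2 ^ κ))) (c := fun _ => 1)
      (A := (A ∪ Set.range w) ∪ Set.range o) (B := fun i => ({G i k * o i} : Set K))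
      (fun i _ => Derivable.mul ?_ (Or.inl (Or.inr ⟨i, rfl⟩)))
    · refine key.mono (by simp) le_rfl ?_
      rintro x ⟨i, rfl⟩
      exact Set.mem_biUnion (Finset.mem_coe.2 (Finset.mem_univ i)) rfl
    · rcases hG i k with h | h
      · exact Or.inl (Or.inl (Or.inl h))
      · exact Or.inr h
  exact (h0.trans (h1.trans h2)).mono (le_of_eq (by ring)) le_rfl le_rfl

/-- **The matvec engine**: `i ↦ ∑_k G i k · ∑_j ε/(aω^i − bω^j) · H j k · v j` (a Cauchy-like
matrix with generator `(G, H)` on the two cosets, applied to `v`) costs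
`card p · (2κ + 5) · 2^κ` steps. [folklore] -/
theorem derivable_cauchy_engine (hfft : ∀ (κ : ℕ) (ω : ℂ) (a : ℕ → K) (A : Set K),
      (∀ i < 2 ^ κ, a i ∈ A ∪ Set.range (algebraMap ℂ K)) →
      Derivable ℂ (κ * 2 ^ κ) A {v | ∃ j < 2 ^ κ, v = fft κ (algebraMap ℂ K ω) a j})
    {κ : ℕ} {ω a b : ℂ} (hω : IsPrimitiveRoot ω (2 ^ κ)) (ha : a ≠ 0)
    (hab : ∀ i j : ℕ, a * ω ^ i ≠ b * ω ^ j) (ε : ℂ) {p : Type} [Fintype p]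
    (G H : Matrix (Fin (2 ^ κ)) p K) (v : Fin (2 ^ κ) → K) (A : Set K)
    (hG : ∀ i k, G i k ∈ A ∪ Set.range (algebraMap ℂ K))
    (hH : ∀ i k, H i k ∈ A ∪ Set.range (algebraMap ℂ K))
    (hv : ∀ i, v i ∈ A ∪ Set.range (algebraMap ℂ K)) :
    Derivable ℂ (Fintype.card p * (2 * κ + 5) * 2 ^ κ) A (Set.range fun i : Fin (2 ^ κ) =>
      ∑ k : p, G i k * ∑ j : Fin (2 ^ κ),
        algebraMap ℂ K (ε / (a * ω ^ (i : ℕ) - b * ω ^ (j : ℕ))) * (H j k * v j)) := by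
  classical
  set P : p → Fin (2 ^ κ) → K := fun k i => G i k * ∑ j : Fin (2 ^ κ),
    algebraMap ℂ K (ε / (a * ω ^ (i : ℕ) - b * ω ^ (j : ℕ))) * (H j k * v j) with hP
  have h1 : Derivable ℂ (∑ k ∈ (Finset.univ : Finset p), (2 * κ + 4) * 2 ^ κ) A
      (⋃ k ∈ (Finset.univ : Finset p), Set.range (P k)) :=
    Derivable.biUnion _ fun k _ => derivable_cauchy_column hfft hω ha hab ε G H v A hG hH hv k
  have h2 : Derivable ℂ (∑ _i ∈ (Finset.univ : Finset (Fin (2 ^ κ))), Fintype.card p)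
      (A ∪ ⋃ k ∈ (Finset.univ : Finset p), Set.range (P k))
      (⋃ i ∈ (Finset.univ : Finset (Fin (2 ^ κ))), {∑ k : p, P k i}) := by
    refine Derivable.biUnion _ fun i _ => ?_
    have hs := Derivable.sum (k := ℂ) (Finset.univ : Finset p) (fun _ => (1 : ℂ))
      (A := A ∪ ⋃ k ∈ (Finset.univ : Finset p), Set.range (P k)) (x := fun k => P k i)
      (fun k _ => Or.inl (Or.inr (Set.mem_biUnion (Finset.mem_coe.2 (Finset.mem_univ k))
        ⟨i, rfl⟩)))
    simpa using hs
  refine (h1.trans h2).mono ?_ le_rfl ?_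
  · simp only [Finset.sum_const, Finset.card_univ, Fintype.card_fin, smul_eq_mul]
    exact le_of_eq (by ring)
  · rintro x ⟨i, rfl⟩
    exact Set.mem_biUnion (Finset.mem_coe.2 (Finset.mem_univ i)) rfl

/-- **Stub `cauchyMatvec`** — see `Lines/Sketch.lean`. [cite: Pan2001, §3] -/
theorem stub_cauchyMatvec (hfft : ∀ (κ : ℕ) (ω : ℂ) (a : ℕ → K) (A : Set K),
      (∀ i < 2 ^ κ, a i ∈ A ∪ Set.range (algebraMap ℂ K)) →
      Derivable ℂ (κ * 2 ^ κ) A {v | ∃ j < 2 ^ κ, v = fft κ (algebraMap ℂ K ω) a j}) :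
    ∀ (κ : ℕ) (ω a b : ℂ), IsPrimitiveRoot ω (2 ^ κ) → a ≠ 0 → b ≠ 0 →
      (∀ i j : ℕ, a * ω ^ i ≠ b * ω ^ j) →
      ∀ (p : Type) [Fintype p] [DecidableEq p] (G H : Matrix (Fin (2 ^ κ)) p K)
        (v : Fin (2 ^ κ) → K) (A : Set K),
      (∀ i k, G i k ∈ A ∪ Set.range (algebraMap ℂ K)) →
      (∀ i k, H i k ∈ A ∪ Set.range (algebraMap ℂ K)) →
      (∀ i, v i ∈ A ∪ Set.range (algebraMap ℂ K)) →
      Derivable ℂ (Fintype.card p * (2 * κ + 7) * 2 ^ κ) A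
          (Set.range ((cauchyLike (fun i : Fin (2 ^ κ) => algebraMap ℂ K (a * ω ^ (i : ℕ)))
            (fun j : Fin (2 ^ κ) => algebraMap ℂ K (b * ω ^ (j : ℕ))) G H).mulVec v)) ∧
        Derivable ℂ (Fintype.card p * (2 * κ + 7) * 2 ^ κ) A
          (Set.range (Matrix.vecMul v (cauchyLike (fun i : Fin (2 ^ κ) => algebraMap ℂ K (a * ω ^ (i : ℕ)))
            (fun j : Fin (2 ^ κ) => algebraMap ℂ K (b * ω ^ (j : ℕ))) G H))) := by
  intro κ ω a b hω ha hb hab p _ _ G H v A hG hH hv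
  have hcost : Fintype.card p * (2 * κ + 5) * 2 ^ κ ≤ Fintype.card p * (2 * κ + 7) * 2 ^ κ :=
    Nat.mul_le_mul_right _ (Nat.mul_le_mul_left _ (by omega))
  constructor
  · have hmv : (cauchyLike (fun i : Fin (2 ^ κ) => algebraMap ℂ K (a * ω ^ (i : ℕ)))
        (fun j : Fin (2 ^ κ) => algebraMap ℂ K (b * ω ^ (j : ℕ))) G H).mulVec v =
        fun i : Fin (2 ^ κ) => ∑ k : p, G i k * ∑ j : Fin (2 ^ κ),
          algebraMap ℂ K (1 / (a * ω ^ (i : ℕ) - b * ω ^ (j : ℕ))) * (H j k * v j) := by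
      funext i
      simp only [Matrix.mulVec_apply_eq_sum, cauchyLike_apply, map_div₀, map_one, map_sub,
        Finset.sum_div, Finset.sum_mul, Finset.mul_sum]
      rw [Finset.sum_comm]
      exact Finset.sum_congr rfl fun k _ => Finset.sum_congr rfl fun j _ => by ring
    rw [hmv]
    exact (derivable_cauchy_engine hfft hω ha hab 1 G H v A hG hH hv).mono hcost le_rfl le_rfl
  · have hab' : ∀ i j : ℕ, b * ω ^ i ≠ a * ω ^ j := fun i j h => hab j i h.symm
    have hvm : Matrix.vecMul v (cauchyLike (fun i : Fin (2 ^ κ) => algebraMap ℂ K (a * ω ^ (i : ℕ)))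
        (fun j : Fin (2 ^ κ) => algebraMap ℂ K (b * ω ^ (j : ℕ))) G H) =
        fun j : Fin (2 ^ κ) => ∑ k : p, H j k * ∑ i : Fin (2 ^ κ),
          algebraMap ℂ K ((-1) / (b * ω ^ (j : ℕ) - a * ω ^ (i : ℕ))) * (G i k * v i) := by
      funext j
      simp only [Matrix.vecMul_apply_eq_sum, cauchyLike_apply, map_div₀, map_neg, map_one,
        map_sub, Finset.sum_div, Finset.mul_sum]
      rw [Finset.sum_comm]
      refine Finset.sum_congr rfl fun k _ => Finset.sum_congr rfl fun i _ => ?_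
      have hne : algebraMap ℂ K (b * ω ^ (j : ℕ)) - algebraMap ℂ K (a * ω ^ (i : ℕ)) ≠ 0 := by
        rw [← map_sub]
        exact (map_ne_zero _).2 (sub_ne_zero.2 (hab' j i))
      have hne' : algebraMap ℂ K (a * ω ^ (i : ℕ)) - algebraMap ℂ K (b * ω ^ (j : ℕ)) ≠ 0 := by
        rw [← map_sub]
        exact (map_ne_zero _).2 (sub_ne_zero.2 (hab i j))
      field_simp
      ring
    rw [hvm]
    exact (derivable_cauchy_engine hfft hω hb hab' (-1) H G v A hH hG hv).mono hcost le_rfl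
      le_rfl

end KLevel

end

end Summit.MatrixMultiplication.MatrixMultiplication.Theorems
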